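import Literature.MathematicalPhysics.QuantumFieldTheory.Balaban1983to89.Beta.PlaquetteWeitzenbock

/-!
# `BalabanUV.Beta.D1BFx.FeynmanLocalVertex` — road «BF-x» for binder row D1, leaf A1.i: THE LOCAL BACKGROUND-FEYNMAN VERTEX.
# The Wilson action's `B`-linear one-bond Hessian germ PLUS the `B`-linear germ of the covariant-divergence weight `−½Σ_x τ((div_{U}W)(x)²)`
# IS an3's model vector vertex `SpinTable.vecVertex (−2)` EXACTLY up to the grading-(t)-two remainder — the longitudinal germ `divGerm`
# that an3's `PlaquetteWeitzenbock.actionJet21_eq_vecVertex` «separated, not eliminated» is disposed of by the gauge-fixing weight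

HONEST FRAMING (cell contract, verbatim): «discharging `BetaPertH` makes Bałaban's UV stability UNCONDITIONAL — a real constructive-QFT
result; it is NOT the continuum limit and NOT the Clay problem.»  This module is [folklore] finite non-commutative algebra on a finite periodic
lattice — three corollaries of an3's `PlaquetteWeitzenbock` (gen 11) BY NAME; it cites nothing, mints no `Prop`, discharges nothing of the wall.
NOT summit progress; NOT continuum, NOT Clay.

ABSOLUTE RULE (cell, verbatim): «No internally-minted statement may enter as a cited fact. Every hypothesis is either kernel-proved in this
package or a verbatim quotation of a PUBLISHED theorem with page reference. The manuscript(s) under audit are NOT citable for their own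
disputed steps — they are the thing under adjudication; programme-internal (2001/route/tribunal) claims are never citable.»

WHY (skeleton `HOME/beta/skeletons/D1-b2b-balaban-beta-d1-p2.md` v1.3, node A, leaf A1 «MAIN term = realised table»; TYPER-SPEC §1 T4 / §3).  In the
background-Feynman representation of road BF-x the fine gluon operator is B9 (3.26)'s `Δ_a(U) = Δ₁(U) + D_U R_U D_U* + Q(U)*aQ(U)` (at `U = 1`:
B5 (1.69) `Δ − ∂P∂* + aQ*Q`, `R = I − P`; CONTEXT only).  Its gauge-fixing weight splits as `½‖R_U D_U*W‖² = ½‖D_U*W‖² − ½‖P_U D_U*W‖²`: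
a LOCAL covariant-divergence square and a block-structured (finite rank per block) correction.  an3 proved (`actionJet21_eq_vecVertex`):
`−½·jet21 = ½·vᵀ·vecVertex(sTot)·v + divGerm + remainder`, `sTot = −2`, MODULO «(a) the LONGITUDINAL germ divGerm, separated here and
NOT eliminated (its disposal is the gauge fixing DRD* of B9 (3.26))».  THIS FILE records that disposal for the LOCAL part: the `B`-linear germ
of `½Σ_x τ((covDiv₁ W B)(x)²)` IS `divGerm` (an3's `sum_covDiv₁_sq`), so the Feynman-weighted germ `−½·jet21 − divGerm` is the model vertex
`½·vᵀ vecVertex(−2) v` up to `remainder` — no longitudinal germ left.  The `P`-part `−½‖P_U D_U*W‖²` is NOT here (skeleton leaf J5/A3: block-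
structured).  So, for the lattice background-Feynman functional, an3's `SpinTable.three_sectors_bf` (realised kernel `8N²·D_{μν}(g²) −
4N²·cellForm g`, germ `leadingIntegrand (kappaBal N)`) applies with NO «modulo (a)».

CONTENT (all [folklore]; `τ` tracial; every `W`, `B`, `e`, finite periodic `Λ`).
* `feynmanWeight21 τ e W B := ½•(Σ_x τ(covDiv₁²) − Σ_x τ(divW²) − Σ_x τ(divTwist²))` — the `B`-LINEAR germ of the weight `½Σ_x τ((div_U W)²)`
  (total minus its `B`-free and `B`-quadratic parts), and `feynmanWeight21_eq_divGerm : feynmanWeight21 = divGerm` (`sum_covDiv₁_sq`).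
* `wilson_sub_feynmanWeight21_eq_vecVertex` — THE LOCAL BF VERTEX: in `SpinTable`'s coordinates at the one-bond background `(z, γ, Y)`,
  `−½·jet21 − feynmanWeight21 = ½·v ⬝ᵥ (vecVertex sTot e z γ (adM τ t Y) *ᵥ v) + remainder` (`actionJet21_eq_vecVertex` − `divGerm`).
* `wilson_sub_feynmanWeight21_eq_current_add_spin` — the same with the two sectors displayed (`current(copies)` = the Feynman kinetic vertex of
  `card D` copies, `sTot·spinVertex` = both spin units).
Orientation of the weight (why MINUS `divGerm`): in an3's convention `S₂ = ½·vᵀHv` with `S = Σ_p (1 − Re τU(∂p))` the trace `τ` of a square of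
`𝔤`-letters is non-positive, so the POSITIVE Feynman weight is `−½Σ_x τ((div_U W)²)`, whose `B`-linear germ is `−divGerm`.
-/

namespace Summit.QuantumFields.BalabanUV.Beta.D1BFx.FeynmanLocalVertex

open Finset
open scoped BigOperators Matrix
open Literature.MathematicalPhysics.QuantumFieldTheory.Balaban1983to89.Beta
open Literature.MathematicalPhysics.QuantumFieldTheory.Balaban1983to89.Beta.GhostTable (current copies)
open Literature.MathematicalPhysics.QuantumFieldTheory.Balaban1983to89.Beta.SpinTable (spinVertex vecVertex)
open Literature.MathematicalPhysics.QuantumFieldTheory.Balaban1983to89.Beta.ColourTrace (adMat)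
open Literature.MathematicalPhysics.QuantumFieldTheory.Balaban1983to89.Beta.PlaquetteVertex (jet21 field bondLetter adM)
open Literature.MathematicalPhysics.QuantumFieldTheory.Balaban1983to89.Beta.PlaquetteWeitzenbock
  (divW divTwist covDiv₁ divGerm sum_covDiv₁_sq sTot remainder actionJet21_eq_vecVertex actionJet21_eq_current_add_spin)

/-! ## §1 The `B`-linear germ of the covariant-divergence weight is `divGerm` -/

section Forms

variable {𝕜 : Type*} [Field 𝕜] [CharZero 𝕜] {𝔸 : Type*} [Ring 𝔸] [Module 𝕜 𝔸] {V : Type*} [AddCommGroup V] [Module 𝕜 V]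
variable {Λ : Type*} [Fintype Λ] [AddCommGroup Λ] {D : Type*} [Fintype D]

/-- [folklore] **THE `B`-LINEAR GERM OF THE FEYNMAN WEIGHT** `½Σ_x τ((div_U W)(x)²)` at `U = e^{B}`, first order: total minus the `B`-free
square `½Σ τ(divW²)` minus the `B`-quadratic square `½Σ τ(divTwist²)`. -/
noncomputable def feynmanWeight21 (τ : 𝔸 →ₗ[𝕜] V) (e : D → Λ) (W B : Λ → D → 𝔸) : V :=
  (2 : 𝕜)⁻¹ • ((∑ x, τ (covDiv₁ e W B x * covDiv₁ e W B x)) - (∑ x, τ (divW e W x * divW e W x))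
    - ∑ x, τ (divTwist e W B x * divTwist e W B x))

/-- [folklore] `feynmanWeight21 = divGerm` (an3's `sum_covDiv₁_sq`: `Σ τ(covDiv₁²) = Σ τ(divW²) + 2•divGerm + Σ τ(divTwist²)`). -/
theorem feynmanWeight21_eq_divGerm (τ : 𝔸 →ₗ[𝕜] V) (hτ : ∀ a b : 𝔸, τ (a * b) = τ (b * a)) (e : D → Λ) (W B : Λ → D → 𝔸) :
    feynmanWeight21 τ e W B = divGerm τ e W B := by
  unfold feynmanWeight21
  rw [sum_covDiv₁_sq τ hτ e W B]
  have h : (∑ x, τ (divW e W x * divW e W x)) + 2 • divGerm τ e W B + (∑ x, τ (divTwist e W B x * divTwist e W B x))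
      - (∑ x, τ (divW e W x * divW e W x)) - (∑ x, τ (divTwist e W B x * divTwist e W B x)) = 2 • divGerm τ e W B := by abel
  rw [h, two_smul, ← two_smul 𝕜, smul_smul, inv_mul_cancel₀ (two_ne_zero), one_smul]

end Forms

/-! ## §2 The local background-Feynman vertex IS the model vector vertex -/

section Coordinates

variable {𝔸 : Type*} [NormedRing 𝔸] [NormedAlgebra ℝ 𝔸]
variable {Λ : Type*} [Fintype Λ] [DecidableEq Λ] [AddCommGroup Λ] {C : Type*} [Fintype C] {D : Type*} [Fintype D] [DecidableEq D]

/-- [folklore] **THE LOCAL BF VERTEX.**  In `SpinTable`'s coordinates, at the one-bond background `(z, γ, Y)`, for every fluctuation `v` and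
tracial `τ`: the Wilson `(2,1)`-germ in the Hessian convention MINUS the Feynman weight's `(2,1)`-germ is EXACTLY the model vector vertex at
`sTot = −2` plus an3's grading-(t)-two remainder — the longitudinal germ is gone:
`−½·jet21 − feynmanWeight21 = ½·v ⬝ᵥ (vecVertex sTot e z γ (adM Y) *ᵥ v) + remainder`. -/
theorem wilson_sub_feynmanWeight21_eq_vecVertex (τ : 𝔸 →ₗ[ℝ] ℝ) (hτ : ∀ a b : 𝔸, τ (a * b) = τ (b * a)) (t : C → 𝔸)
    (e : D → Λ) (v : Λ × (C × D) → ℝ) (z : Λ) (γ : D) (Y : 𝔸) :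
    -((2 : ℝ)⁻¹ * jet21 ℝ τ e (field t v) (bondLetter z γ Y)) - feynmanWeight21 τ e (field t v) (bondLetter z γ Y) =
      (2 : ℝ)⁻¹ * (v ⬝ᵥ (vecVertex sTot e z γ (adM τ t Y) *ᵥ v)) + remainder τ e (field t v) (bondLetter z γ Y) := by
  rw [feynmanWeight21_eq_divGerm τ hτ, actionJet21_eq_vecVertex τ hτ]
  ring

/-- [folklore] The same with the two sectors displayed: Feynman kinetic vertex of the `card D` copies plus BOTH spin units,
`−½·jet21 − feynmanWeight21 = ½·vᵀ current(copies (adM Y)) v + ½·sTot·vᵀ spinVertex(adM Y) v + remainder`. -/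
theorem wilson_sub_feynmanWeight21_eq_current_add_spin (τ : 𝔸 →ₗ[ℝ] ℝ) (hτ : ∀ a b : 𝔸, τ (a * b) = τ (b * a)) (t : C → 𝔸)
    (e : D → Λ) (v : Λ × (C × D) → ℝ) (z : Λ) (γ : D) (Y : 𝔸) :
    -((2 : ℝ)⁻¹ * jet21 ℝ τ e (field t v) (bondLetter z γ Y)) - feynmanWeight21 τ e (field t v) (bondLetter z γ Y) =
      (2 : ℝ)⁻¹ * (v ⬝ᵥ (current z (e γ) (copies D (adM τ t Y)) *ᵥ v))
        + (2 : ℝ)⁻¹ * sTot * (v ⬝ᵥ (spinVertex e z γ (adM τ t Y) *ᵥ v)) + remainder τ e (field t v) (bondLetter z γ Y) := by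
  rw [feynmanWeight21_eq_divGerm τ hτ, actionJet21_eq_current_add_spin τ hτ]
  ring

end Coordinates

end Summit.QuantumFields.BalabanUV.Beta.D1BFx.FeynmanLocalVertex
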